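import Mathlib
import HarnessLib
import HarnessLib.Audit
import Summits.QuantumAdvantage.Statement
import Summits.QuantumAdvantage.AdviceFreeQNC0.AdviceFreeQNC0
import Summits.QuantumAdvantage.AdviceFreeQNC0.RingHardOdd
import Summits.QuantumAdvantage.AdviceFreeQNC0.AdviceFreeQNC0Three
import Summits.QuantumAdvantage.AdviceFreeQNC0.RingLocalPolylog
import HarnessLib.Audit.Status.Attr

/-!
Route: PumpingDial

# Route PumpingDial — RingHardOdd 3's uniform covariant face — gated local rules, finite
certificates by two pumping principles, a uniformity bridge, a declared residual (rung F-Q1-p3)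

DECOMPOSITION CELL decomp-qadv (D-0178/D-0179; doctrine D-0170/0171/0172), RESIDUAL MODE, node
PumpingDial (lens decomp-qadv-lens-5 generation 3 «finite/base range + asymptotic regime + bridge»;
NODE 2026-08-30T03:38:54Z + erratum 03:39:06Z; node file
run/shared/lean/pub/decomp-qadv/decomp-qadv-lens-5/PumpingDial.lean sha256 bf758383…fb27, 926 lines,
lean check rc 0 · 0 sorry; writer certificate sk/PumpingDialSketch.lean: every item below ↔ the
node's decl by `Iff.rfl`, rc 0); critic decomp-qadv-crit-1 g2 CLEARED 2026-08-30T03:50:48Z,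
CRITIC-LEDGER row 16 (S NECESSARY·WEAKER·CONTENTFUL·OPEN·ATTACKABLE; U UNDECIDED(test U1)·WEAKER; R
DECLARED RESIDUAL T-grade NO-SHRINK honest; GapDichotomy3/ZeroPump3 theorem-grade LAND FIRST; kill
lane IOPerfect3 = row 14's ask). RUNG CURRENCY ONLY — NOTHING HERE BEARS ON THE ROOT
`QuantumAdvantage := ∃ L, L ∈ BQP ∧ L ∉ BPP`; the leaf is F-Q1-p3 `AdviceFreeQNC0Three`. SIBLING
rung route of DegreeDial / ProductDial / ExactnessDial on the blocker T := `RingHardOdd 3`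
(DWalkThree stmt-QuantumAdvantage-22907's open content): a THIRD independent dial — the automaton
TYPE of a uniform covariant strategy — next to degree (DegreeDial) and loss × ring-count
(ProductDial). It suffices to show X = SymGatedHardOdd3 (ONE θ < 1 bounding the odd-class value of
every mod-3-gated local rule of polylog type) together with the declared residual R = SymGatedLift3
(X → T); X is filed as S ∧ U: S = SteerHardOdd3 (each FIXED finite rule type (q,3,r) has value ≤
θ(q,r) < 1 for all large n — decidable per type modulo the theorem-grade GapDichotomy3 by the
spectral certificate NoAsympPerfect3) and U = UniformityLift3 (S → X, a spectral gap uniform in the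
type). T → S, T → X, S's and X's m = 1 digits (LocalHardOdd3, LocalUniform3) are all PROVED in the
node; the kill path IOPerfect3 → ¬T is PROVED.
Lean: `∃ θ : ℝ, θ < 1 ∧ ∀ c : ℕ, ∃ n₀ : ℕ, ∀ n ≥ n₀, ∀ (q r : ℕ) [NeZero q], q ≤ (Nat.log 2 n) ^ c →
r ≤ (Nat.log 2 n) ^ c → ∀ F : ((Fin q → Fin 3) → (Fin (2 * r + 1) → Bool) → Bool),
((Finset.univ.filter fun x : Fin n → Bool => Summit.QuantumAdvantage.AdviceFreeQNC0.OddZeros x ∧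
Literature.Computability.QuantumComplexity.RingHLF.Rel x (fun b : Fin n => F (fun s : Fin q =>
(⟨(Finset.univ.filter fun i : Fin n => (i.val + n - b.val) % n % q = s.val ∧ x i = true).card % 3,
Nat.mod_lt _ (Nat.succ_pos 2)⟩ : Fin 3)) (fun j : Fin (2 * r + 1) => x ⟨(b.val + (n - r % n) +
j.val) % n, Nat.mod_lt _ b.pos⟩))).card : ℝ) ≤ θ * (2 : ℝ) ^ (n - 1)`

## Assembly
`closes` (glue.lean, one line): `adviceFreeQNC0Three_of_ringHardOdd (hR (hU hS))` — S gives, through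
the bridge U, the asymptotic regime SymGatedHardOdd3, the residual R lifts it to T = RingHardOdd 3,
and the landed `Summit.QuantumAdvantage.AdviceFreeQNC0.adviceFreeQNC0Three_of_ringHardOdd`
(AdviceFreeQNC0Three.lean:33) gives the leaf (closes_target F-Q1-p3). Certificate reading (node
closes₂): S ⇐ GapDichotomy3 ∧ NoAsympPerfect3 by CertGlue3 (PROVED) — the registered skeleton of S.
The Assembly item restates `closes` as a Prop; the deciding theorem is `closes`.

CLOSES_TARGET: closes rung F-Q1-p3 of QuantumAdvantage: Summit.QuantumAdvantage.AdviceFreeQNC0.AdviceFreeQNC0Three (D-0061; not the summit Statement) — the deciding theorem of this route concludes that registered leaf instead of the Statement decl `QuantumAdvantage` (class rung: servable and labelled, never counted as concluding the summit Statement).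

Rationale: WHY THIS LINE. Item 22907's own why-might-fail names the enemy of T: «a dense adaptive 𝔽₃-strategy —
local rules gated by global mod-3 moments — could steer the walk»; census-1 g3 (kit j337947 (A))
measured exactly that object: a covariant affine rule gated by Σxᵢ mod 3 is PERFECT on the odd class
for every N ≤ 8 and for NO N ∈ [9,17] (critic row 14: small-N artefact, LAW F4 «covariance is free,
the content is the degree»), and the critic asked for «a UNIFORM family + a proof shape + a pumping
bridge». This route types that object as the finite rule types FS(q,3,r) (gate = class counts mod 3
over offsets mod q, window of radius r; every rule an 𝔽₃-polynomial tuple of constant degree ≤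
2q+2r+1, so T → each slice is proved, not assumed) and imports FINITE-AUTOMATA / TRANSFER-OPERATOR
ASYMPTOTICS (Perron–Frobenius on the nonnegative transfer matrix of one deterministic automaton
reading x once; Boolean matrix periodicity; book:lawson2003-finite-automata,
book:delorme1999-cellular-automata) to turn the census's finite N-tables into theorems about ALL
ring lengths: GapDichotomy3 (value converges along residue classes, exponentially fast, uniformly
over the finite type) and ZeroPump3 (exactness is eventually periodic) — both theorem-grade — make
S|_(q,r) and NoPerfectSteer3|_(q,r) FINITE CERTIFICATES (tests M3, X1 of the census plan). Nearest
print: BarrettEtAl2007 §IV.A (bounded-range-communication LHV models cannot reproduce the n-cycle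
graph-state correlations = the m = 1 exactness digit qualitatively; the tree's ringLocal_polylog_lt3
is its quantitative θ-form); BGK18 arXiv:1704.00690 uses light-cone locality, no automata. New
relative to every listed route: the automaton face of T with its two pumping principles and a typed
kill lane; the residual R is honest T-grade (no shrink claimed).

RANKED CRUXES. #2 SteerHardOdd3 (crux) — S (the FINITE-TYPE face of T = RingHardOdd 3): for every
offset period q and radius r there are θ(q,r) < 1 and n₀(q,r) such that for all ring lengths n ≥ n₀
EVERY mod-3-gated local rule F of type (q,3,r) (output bit at b = F(vector over offset classes s mod
q of #{i : i−b ≡ s (mod q), x_i = 1} mod 3, the 2r+1 window bits around b)) satisfies the ring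
relation RingHLF.Rel on at most θ·2^(n−1) odd-class patterns. NECESSARY (T → S proved in the lens
node, degree lemma: every such rule is an 𝔽₃-polynomial tuple of constant degree ≤ 2q+2r+1); its m =
1 digit LocalHardOdd3 is PROVED (tree ringLocal_polylog_lt3). Certificate form: S|_(q,r) ⟺
NoAsympPerfect3|_(q,r) modulo the theorem-grade GapDichotomy3 (CertGlue3 PROVED; S → NoAsympPerfect3
trivial). [difficulty: L] (why it might fail: a gated rule with many offset classes could emulate a
sparse periodic bell pattern of value above every fixed θ; for FIXED (q,r) this needs an
asymptotically perfect rule, against census (A) (no perfect steered rule at N ∈ [9,17]).)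
[arXiv:1704.00690, BarrettEtAl2007, book:lawson2003-finite-automata, kit:j337947,
Summit.QuantumAdvantage.AdviceFreeQNC0.ringLocal_polylog_lt3]
#4 UniformityLift3 (crux) — U, THE BRIDGE of the dial: from the fixed-type value bounds θ(q,r) < 1
(S) to ONE θ at polylog-growing type (SymGatedHardOdd3). Content: sup_{q,r} θ(q,r) < 1 AND
convergence thresholds n₀(q,r) ≤ 2^{poly(q+r)} (a spectral gap of the gated transfer operators
uniform in the type). Internal to the gated-local class; its m = 1 analogue is a tree theorem (one θ
for all radii ≤ (log₂ N)^C); census test U1 (uniformity trend) informs it. [deps: SteerHardOdd3,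
SymGatedHardOdd3] [difficulty: L] (why it might fail: θ(q,r) → 1 as the type grows (rules playing
the kernel guess off a rare window pattern, θ(q,r) ≥ 1 − 2^{−r}) with thresholds n₀(q,r) that do not
separate from the polylog regime — then the bridge is false while T may survive.) [arXiv:1704.00690,
BarrettEtAl2007, book:lawson2003-finite-automata, kit:j337947,
Summit.QuantumAdvantage.AdviceFreeQNC0.ringLocal_polylog_lt3]
#5 SymGatedLift3 (crux) — R, DECLARED RESIDUAL (T-grade, NO-SHRINK, honest): from ONE θ for all
mod-3-gated local rules of polylog type (SymGatedHardOdd3) to ALL polylog-degree 𝔽₃ strategies (T =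
RingHardOdd 3). Carries position dependence and aperiodic n-dependent tails = all of T outside its
uniform covariant face; ¬R says nothing about T (R ≡ T mod SymGatedHardOdd3). Vacuous unless the
dial below it closes; the route's merit is that S and U become theorems about all ring lengths with
finite certificates and that the kill path (IOPerfect3) is typed. [deps: SymGatedHardOdd3]
[difficulty: open-problem] (why it might fail: it is T-grade: a structure theorem «near-optimal
polylog-degree strategies are approximable by gated local rules of polylog type» is not in sight
(the 2/3 extremisers are one aperiodic bell); above degree log₂ n it is
NonclassicalDegreeLogBarrier-adjacent.) [arXiv:1704.00690,
Literature.Barriers.QuantumAdvantage.NonclassicalDegreeLogBarrier, kit:j337947]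
#9 SymGatedHardOdd3 (support) — the ASYMPTOTIC REGIME of the dial (banked node, referenced by
UniformityLift3 and SymGatedLift3): ONE θ < 1 such that for every c, all large n, all types q, r ≤
(log₂ n)^c and every mod-3-gated local rule of type (q,3,r), the odd-class win count is ≤ θ·2^(n−1).
T → SymGatedHardOdd3 PROVED in the node (degree 2q+2r+1 ≤ (log₂ n)^(c+2)); its m = 1 analogue
LocalUniform3 is PROVED (= ringLocal_polylog_lt3). [difficulty: L]
#9 NoAsympPerfect3 (support) — CERTIFICATE FORM of S (critic rank-3 designate; filed as a banked
skeleton piece of S because only the closes-cone is staffed at birth — promote to crux when S's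
skeleton {GapDichotomy3, NoAsympPerfect3, CertGlue3} is registered): for every type (q,3,r), every α
∈ [0,1), every rule F and every arithmetic progression of lengths ρ + per·t (per > 0), the odd-class
LOSS 2^(n−1) − winOdd exceeds α^n·2^(n−1) for infinitely many t — no rule is exponentially close to
perfect along any progression. Decided per rule by the unit-modulus eigen-sector of the gated
transfer matrix (census test M3). S → NoAsympPerfect3 is trivial; the converse holds modulo
GapDichotomy3 (CertGlue3, PROVED). [difficulty: L]
#9 GapDichotomy3 (support) — THEOREM-GRADE, LAND FIRST (finite automata; true whatever T's fate):
for every type (q,3,r) there are θ < 1 and α ∈ [0,1) such that every rule F has a period per > 0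
with, along every residue class ρ mod per, EVENTUALLY either winOdd ≤ θ·2^(n−1) or 2^(n−1) − winOdd
≤ α^n·2^(n−1). Mechanism: winOdd n F = u·M^n·v for the nonnegative integer transfer matrix (row sums
2) of one deterministic automaton reading x once; peripheral spectrum of M/2 = roots of unity with
trivial Jordan blocks (Perron–Frobenius per closed class) ⇒ winOdd/2^(n−1) = Σ_ζ c_ζ ζ^n + O(n^d
λ^n), λ < 1, uniformly over the finite type. Banked skeleton piece of S (see NoAsympPerfect3).
[difficulty: L]
#9 CertGlue3 (support) — PROVED in the lens node (fsHard_of_gapDichotomy, uniformity over the finite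
rule type by Finset.sup; port target, land first): GapDichotomy3 → NoAsympPerfect3 → SteerHardOdd3.
The registered skeleton of S is exactly {stub GapDichotomy3, stub NoAsympPerfect3, S_of =
CertGlue3}. [difficulty: provable-now]
#9 ZeroPump3 (support) — THEOREM-GRADE (Boolean transfer-matrix powers are eventually periodic): for
every type (q,3,r) ONE period per > 0 and threshold n₁ such that for every rule F and every n ≥ n₁,
F is perfect on the odd class at length n iff at length n + per. With it the exactness slice
NoPerfectSteer3 is DECIDED by one period window [n₁, n₁+per) (node noPerfectFS_of_window, PROVED)
and ONE perfect length n ≥ n₁ pumps to IOPerfect3 (node ioPerfect3_of_zeroPump). [difficulty: M]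
#9 NoPerfectSteer3 (support) — EXACTNESS slice (banked; the FS-slice of ExactnessDial's
NoPerfectOdd3 stmt-26532 and of T; necessity from T PROVED in the node): for every type (q,3,r),
eventually (n ≥ n₁(q,r)) no mod-3-gated local rule is perfect on the odd class. Census (A) kit
j337947: the symmetric-hash steered affine rule is perfect for every N ≤ 8 and for NO N ∈ [9,17];
test X1 certifies the pump window. [difficulty: M]
#9 IOPerfect3 (support) — REFUTER LANE = the typed KILL PATH of T (critic row 14's ask): some
mod-3-gated local rule of some fixed type is perfect on the odd class for infinitely many ring
lengths. IOPerfect3 → ¬ RingHardOdd 3 PROVED in the node (not_ringHardOdd_of_ioPerfect3); with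
ZeroPump3 one certified perfect length n ≥ n₁ suffices (not_ringHardOdd_of_pump). Dormant for q = 1
by census (A); stays typed for q-periodic gates. [difficulty: M]
#9 LocalHardOdd3 (support) — PROVED in the lens node (BC5 WITNESS of S, one gate digit below: m = 1
= ungated local rules): for every (q,r), θ < 1 and n₀ with every radius-r local rule winning ≤
θ·2^(n−1) odd patterns for n ≥ n₀ — the tree theorem ringLocal_polylog_lt3 at constant radius.
Outside T's known regime: T's smallest slice (affine, DegreeDial AffineCore3 24214) is open while
this digit is a theorem. [difficulty: provable-now]
#9 LocalUniform3 (support) — PROVED in the lens node (BC5 WITNESS of SymGatedHardOdd3 / of U's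
conclusion one digit below): ONE θ < 1 for ALL ungated local rules of radius ≤ (log₂ n)^c, every c —
ringLocal_polylog_lt3 verbatim in rule-table vocabulary. [difficulty: provable-now]
#9 SteerPolyLoss3 (support) — ALL-PATTERN TWIN in ProductDial's loss grammar (banked; NECESSARY for
ProductDial.PolyLoss3 stmt-26123 — PolyLoss3 → SteerPolyLoss3 PROVED in the node): for every type
(q,3,r) there are k, n₀ with every rule winning at most (1 − n^{−k})·2^n of ALL patterns for n ≥ n₀.
The lift SteerPolyLoss3 → PolyLoss3 (node closes₃, residual strictly below T) is NOT filed
(ProductDial is at its 15-item cap); recorded here for the junction. [difficulty: M]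
#9 SteerLift3 (support) — composite residual U∘R kept for the one-residual reading (node closes₁: S
→ SteerLift3 → leaf): SteerHardOdd3 → RingHardOdd 3. Banked, T-grade. [difficulty: open-problem]

TWO-LAYER PLAN. Layer 1 (filed binders): S, U, R → leaf. Layer 2 (banked as asides now, = S's
registered skeleton): S ⇐ GapDichotomy3 ∧ NoAsympPerfect3 (CertGlue3 PROVED); exactness sub-dial
NoPerfectSteer3 ⇐ ZeroPump3 + one certified period window (node noPerfectFS_of_window PROVED).
Foreseen glued splits NOT filed: U into «sup θ(q,r) < 1» and «n₀(q,r) ≤ 2^{poly(q+r)}»; never a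
third layer.

KILL CRITERIA. IOPerfect3 (a mod-3-gated local rule of fixed type perfect on the odd class at
infinitely many lengths) refutes T = RingHardOdd 3 (PROVED: not_ringHardOdd_of_ioPerfect3) and with
it S restricted to that type, DWalkThree:22907, DegreeDial:24213 and ExactnessDial:26532; under
ZeroPump3 ONE certified perfect length n ≥ n₁(q,r) suffices (not_ringHardOdd_of_pump). Census order:
M3 (twisted spectra, decides S|_(1,r) and NoAsympPerfect3|_(1,r), r ≤ 4) → X1 (pump window, decides
NoPerfectSteer3|_(1,3,r) for ALL N) → U1 (uniformity trend θ(q,r), informs U). A measured θ(q,r) → 1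
with non-separating thresholds kills U (route closes refuted:UniformityLift3; T survives); a proof
of T (22907) moots the route (T ⇒ S, X proved).

NOT DECOMPOSED YET. U beyond its m = 1 analogue (no uniform-gap argument written); R entirely
(declared residual, IDEA-NEEDED: approximation of near-optimal polylog-degree strategies by gated
local rules); GapDichotomy3's automaton is described in the node docstring (state = window buffer, ≤
4 kernel candidates with parities, zeros parity, class counts mod 3, position mod q; end-verified
guesses) but not typed.

CHEAPEST FALSIFIER. Test M3 of the census plan at type (1,3,r ≤ 3): compute the unit-modulus
eigen-sector mass of the ω^{|x|}-twisted K1 transfer matrices for every radius-≤3 local rule class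
(census K1 engine exists, ≈ 207 876 classes analysed untwisted with value exactly 1/2 = LAW F3); a
class with full odd-class mass in a unit-modulus sector is an asymptotically perfect gated rule ⇒
¬S|_(1,3,r) and, via one perfect length, IOPerfect3 ⇒ ¬T. In-Lean first check: `decide`-sized
exactness of all type-(1,3,1) rules at n = 9..12 against census (A).

NUMBERS. Census (A) kit j337947: symmetric-hash (q = 1, m = 3) steered covariant affine rule PERFECT
on the odd class for every N ≤ 8, for NO N ∈ [9,17], min odd-class loss ≥ 0.30 from N = 12. Census
K1 / LAW F3 (COSTUME-CENSUS-v2 json sha256 28142e6c…): every shift-periodic local rule analysed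
(radius ≤ 4, period ≤ 6) has asymptotic odd-class value EXACTLY 1/2, subleading modulus ≤ 0.958.
Degree lemma: a type-(q,3,r) rule has 𝔽₃-degree ≤ 2q+2r+1 ≤ (log₂ n)^{c+2} once q, r ≤ (log₂ n)^c.
Rule type sizes: |Rule q 3 r| = 2^(3^q · 2^(2r+1)).

DEFINITION REQUESTS. None — every item is typed over existing declarations (OddZeros, RingHLF.Rel,
RingHardOdd, AdviceFreeQNC0Three, Nat.log, Finset.filter); the node's vocabulary (coff, wpos,
window, gate, Rule, ruleOut, winOdd, winAll, PerfectOdd, FSHard, GapDichotomy, NoAsympPerfect,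
ZeroPump, FSPolyLoss) is INLINED in the items and certified equal to the node's decls
(sk/PumpingDialSketch.lean: 14 × Iff.rfl, rc 0).

Novelty: Searches (lens gen 3 + writer, 2026-08-30): lit search --hybrid "transfer matrix cellular automaton
ring hidden linear function shallow circuits" → only general CA texts
[corpus:book:delorme1999-cellular-automata pp 44–82],
[corpus:book:manzoni2023-cellular-automata-discrete-complex-systems p 155]; lit vsearch
"<GapDichotomy in prose>" → [corpus:book:lawson2003-finite-automata p 48] (automata textbooks,
nothing on strategies for relation problems); lit galaxy search "hidden linear function|graph state
on a cycle|parity halving problem" --star all → [galaxy:pdf:3005872880] = BGK18 itself (switching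
lemma / light cones, no automata), no other relevant row of 24; tree rg 'transfer
matri|automaton|eventually periodic|Perron' Summits/QuantumAdvantage → only census K1 data notes and
RingLocalPolylog.lean (locality via walk transport, no automaton, no gate).
Nearest prior art found: in tree — DWalkThree:22907 (T), DegreeDial:24213/24214 (degree axis),
ProductDial:26123/26124 (loss × ring-count axes), ExactnessDial:26532 (exactness on one ring),
RingLocalPolylog `ringLocal_polylog_lt3` (the m = 1 digit); in print — BarrettEtAl2007 §IV.A
(bounded-range LHV models vs the n-cycle graph state: the m = 1 exactness digit, qualitative), BGK18
arXiv:1704.00690 §4 (cycle instances, light-cone argument).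
Delta: the first node that types the UNIFORM COVARIANT FACE of T (gated local rules = covariant
finite-state strategies) and proves that on it hardness and exactness are FINITE CERTIFICATES (v  [refs: 1704.00690, book:delorme1999-cellular-automata, book:manzoni2023-cellular-automata-discrete-complex-systems, book:lawson2003-finite-automata, BarrettEtAl2007]

Barriers (technique_class: transfer-matrix, two-moduli, smolensky, polynomial-method): - technique_class: transfer-matrix, two-moduli, smolensky, polynomial-method (finite-automaton /
transfer-operator asymptotics for the slices; 𝔽₃-polynomial degree bookkeeping for necessity and the
residual)
- Literature.Barriers.QuantumAdvantage.TwoModuliDepthTwo: S, U, X are average-case statements about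
a strategy CLASS (gated local rules) closed under neither restriction nor composition; the barrier
theorem (depth-two MOD_m∘MOD_p circuits, `twoModuliDepthTwo_holds`) does not quantify over them —
outside; the residual R inherits DegreeDial's placement (inside CDH-evasion (1) at output degree ≥
2).
- Literature.Barriers.QuantumAdvantage.NonclassicalDegreeLogBarrier: non-biting for S, U, X
(constant degree 2q+2r+1 per type, a constant θ obtained from automaton asymptotics, not from a
single-polynomial correlation bound `bhowmickLovett_thm31`); ADJACENT for the residual R above
degree log₂ n, exactly as DegreeDial's AffineLift3 and ProductDial's DPLift3 — declared residual, no
evasion claimed.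
- Literature.Barriers.QuantumAdvantage.NaturalProofs: inside-and-unobstructed — bounds against
polylog-degree 𝔽₃-polynomial tuples / finite rule tables, classes without PRFs.
- Literature.Barriers.QuantumAdvantage.Relativization: finite combinatorics of an explicit relation
on n-cycles; no oracle, no class separation claimed (rung currency).
- Literature.Barriers.QuantumAdvantage.Algebrization: idem — no item is a class separation.
- Literature.Barriers.QuantumAdvantage.SeparationPrereq

History (route lifecycle, newest last):
- 2026-08-30T21:43:34Z · RESIDUAL declared: SymGatedLift3 (stmt-QuantumAdvantage-27307) — summit-strength until shown otherwise: writer g7 schema sync (D-0170): residual flag = the route's DECLARED RESIDUAL exactly as its critic-cleared node/docstri (planner-decomp-qadv-writer-1-g7-0)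

sub-problem: QuantumAdvantage · status: draft · opened planner-decomp-qadv-writer-1-g2-0 2026-08-30T04:04:39Z · rev 0 · ledger route-QuantumAdvantage-PumpingDial
GENERATED by the gate from the ledger (D-0016/17). Provers cite these decls: `theorem foo : Summit.QuantumAdvantage.QuantumAdvantage.Theses.PumpingDial.<Decl> := …` in Summits/QuantumAdvantage/QuantumAdvantage/Theorems/<Name>.lean.
-/

namespace Summit.QuantumAdvantage.QuantumAdvantage.Theses.PumpingDial

open scoped BigOperators Topology Manifold Classical MeasureTheory ProbabilityTheory Matrix InnerProductSpace ComplexConjugate ContinuousMap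
open Filter Set Function TopologicalSpace MeasureTheory

attribute [summit_statement] _root_.QuantumAdvantage
attribute [summit_statement] _root_.Summit.QuantumAdvantage.AdviceFreeQNC0.AdviceFreeQNC0Three

open Literature.QuantumAdvantage

/-- item stmt-QuantumAdvantage-27304 · crux · leaf ATTACKABLE · rank 2 · open · by planner
why it might fail: a gated rule with many offset classes could emulate a sparse periodic bell pattern of value above every fixed θ; for FIXED (q,r) this needs an asymptotically perfect rule, against census (A) (no perfect steered rule at N ∈ [9,17]).
sources: arXiv:1704.00690, BarrettEtAl2007, book:lawson2003-finite-automata, kit:j337947, Summit.QuantumAdvantage.AdviceFreeQNC0.ringLocal_polylog_lt3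
[crux] S (the FINITE-TYPE face of T = RingHardOdd 3): for every offset period q and radius r there
are θ(q,r) < 1 and n₀(q,r) such that for all ring lengths n ≥ n₀ EVERY mod-3-gated local rule F of
type (q,3,r) (output bit at b = F(vector over offset classes s mod q of #{i : i−b ≡ s (mod q), x_i =
1} mod 3, the 2r+1 window bits around b)) satisfies the ring relation RingHLF.Rel on at most
θ·2^(n−1) odd-class patterns. NECESSARY (T → S proved in the lens node, degree lemma: every such
rule is an 𝔽₃-polynomial tuple of constant degree ≤ 2q+2r+1); its m = 1 digit LocalHardOdd3 is
PROVED (tree ringLocal_polylog_lt3). Certificate form: S|_(q,r) ⟺ NoAsympPerfect3|_(q,r) modulo the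
theorem-grade GapDichotomy3 (CertGlue3 PROVED; S → NoAsympPerfect3 trivial). [difficulty: L] -/
@[route_item "route-QuantumAdvantage-PumpingDial", crux (bottleneck := work) (experiment := "instrument: kit jobs cited as sources kit:j337947") (source := "ledger D-0171 leaf tag ATTACKABLE on stmt-QuantumAdvantage-27304 + ledger wanted_by.sources on stmt-QuantumAdvantage-27304, 2026-09-01")]
def SteerHardOdd3 : Prop :=
  ∀ (q r : ℕ) [NeZero q], ∃ θ : ℝ, θ < 1 ∧ ∃ n₀ : ℕ, ∀ n ≥ n₀, ∀ F : ((Fin q → Fin 3) → (Fin (2 * r + 1) → Bool) → Bool), ((Finset.univ.filter fun x : Fin n → Bool => Summit.QuantumAdvantage.AdviceFreeQNC0.OddZeros x ∧ Literature.Computability.QuantumComplexity.RingHLF.Rel x (fun b : Fin n => F (fun s : Fin q => (⟨(Finset.univ.filter fun i : Fin n => (i.val + n - b.val) % n % q = s.val ∧ x i = true).card % 3, Nat.mod_lt _ (Nat.succ_pos 2)⟩ : Fin 3)) (fun j : Fin (2 * r + 1) => x ⟨(b.val + (n - r % n) + j.val) % n, Nat.mod_lt _ b.pos⟩))).card : ℝ)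 ≤ θ * (2 : ℝ) ^ (n - 1)

/-- item stmt-QuantumAdvantage-27305 · crux · rank 9 · open · by planner
[support] the ASYMPTOTIC REGIME of the dial (banked node, referenced by UniformityLift3 and
SymGatedLift3): ONE θ < 1 such that for every c, all large n, all types q, r ≤ (log₂ n)^c and every
mod-3-gated local rule of type (q,3,r), the odd-class win count is ≤ θ·2^(n−1). T → SymGatedHardOdd3
PROVED in the node (degree 2q+2r+1 ≤ (log₂ n)^(c+2)); its m = 1 analogue LocalUniform3 is PROVED (=
ringLocal_polylog_lt3). [difficulty: L] -/
@[route_item "route-QuantumAdvantage-PumpingDial"]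
def SymGatedHardOdd3 : Prop :=
  ∃ θ : ℝ, θ < 1 ∧ ∀ c : ℕ, ∃ n₀ : ℕ, ∀ n ≥ n₀, ∀ (q r : ℕ) [NeZero q], q ≤ (Nat.log 2 n) ^ c → r ≤ (Nat.log 2 n) ^ c → ∀ F : ((Fin q → Fin 3) → (Fin (2 * r + 1) → Bool) → Bool), ((Finset.univ.filter fun x : Fin n → Bool => Summit.QuantumAdvantage.AdviceFreeQNC0.OddZeros x ∧ Literature.Computability.QuantumComplexity.RingHLF.Rel x (fun b : Fin n => F (fun s : Fin q => (⟨(Finset.univ.filter fun i : Fin n => (i.val + n - b.val) % n % q = s.val ∧ x i = true).card % 3, Nat.mod_lt _ (Nat.succ_pos 2)⟩ : Fin 3)) (fun j : Fin (2 * r + 1) => x ⟨(b.val + (n - r % n) + j.val) % n, Nat.mod_lt _ b.pos⟩))).card : ℝ) ≤ θ * (2 : ℝ) ^ (n - 1)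

/-- item stmt-QuantumAdvantage-27306 · crux · rank 4 · open · by planner
why it might fail: θ(q,r) → 1 as the type grows (rules playing the kernel guess off a rare window pattern, θ(q,r) ≥ 1 − 2^{−r}) with thresholds n₀(q,r) that do not separate from the polylog regime — then the bridge is false while T may survive.
sources: arXiv:1704.00690, BarrettEtAl2007, book:lawson2003-finite-automata, kit:j337947, Summit.QuantumAdvantage.AdviceFreeQNC0.ringLocal_polylog_lt3
[crux] U, THE BRIDGE of the dial: from the fixed-type value bounds θ(q,r) < 1 (S) to ONE θ at
polylog-growing type (SymGatedHardOdd3). Content: sup_{q,r} θ(q,r) < 1 AND convergence thresholds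
n₀(q,r) ≤ 2^{poly(q+r)} (a spectral gap of the gated transfer operators uniform in the type).
Internal to the gated-local class; its m = 1 analogue is a tree theorem (one θ for all radii ≤ (log₂
N)^C); census test U1 (uniformity trend) informs it. [deps: SteerHardOdd3, SymGatedHardOdd3]
[difficulty: L] -/
@[route_item "route-QuantumAdvantage-PumpingDial", crux (experiment := "instrument: kit jobs cited as sources kit:j337947") (source := "ledger wanted_by.sources on stmt-QuantumAdvantage-27306, 2026-09-01")]
def UniformityLift3 : Prop :=
  SteerHardOdd3 → SymGatedHardOdd3

/-- item stmt-QuantumAdvantage-27307 · crux · RESIDUAL (gen 0; summit-strength until shown otherwise, D-0170) · leaf IDEA-NEEDED · rank 5 · open · by planner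
why it might fail: it is T-grade: a structure theorem «near-optimal polylog-degree strategies are approximable by gated local rules of polylog type» is not in sight (the 2/3 extremisers are one aperiodic bell); above degree log₂ n it is NonclassicalDegreeLogBarrier-adjacent.
sources: arXiv:1704.00690, Literature.Barriers.QuantumAdvantage.NonclassicalDegreeLogBarrier, kit:j337947
[crux] R, DECLARED RESIDUAL (T-grade, NO-SHRINK, honest): from ONE θ for all mod-3-gated local rules
of polylog type (SymGatedHardOdd3) to ALL polylog-degree 𝔽₃ strategies (T = RingHardOdd 3). Carries
position dependence and aperiodic n-dependent tails = all of T outside its uniform covariant face;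
¬R says nothing about T (R ≡ T mod SymGatedHardOdd3). Vacuous unless the dial below it closes; the
route's merit is that S and U become theorems about all ring lengths with finite certificates and
that the kill path (IOPerfect3) is typed. [deps: SymGatedHardOdd3] [difficulty: open-problem] -/
@[route_item "route-QuantumAdvantage-PumpingDial", crux (bottleneck := idea) (experiment := "instrument: kit jobs cited as sources kit:j337947") (source := "ledger wanted_by.residual on stmt-QuantumAdvantage-27307 + ledger wanted_by.sources on stmt-QuantumAdvantage-27307, 2026-09-01")]
def SymGatedLift3 : Prop :=
  SymGatedHardOdd3 → Summit.QuantumAdvantage.AdviceFreeQNC0.RingHardOdd 3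

/-- item stmt-QuantumAdvantage-27308 · aside · rank 9 · open · by planner
[support] CERTIFICATE FORM of S (critic rank-3 designate; filed as a banked skeleton piece of S
because only the closes-cone is staffed at birth — promote to crux when S's skeleton {GapDichotomy3,
NoAsympPerfect3, CertGlue3} is registered): for every type (q,3,r), every α ∈ [0,1), every rule F
and every arithmetic progression of lengths ρ + per·t (per > 0), the odd-class LOSS 2^(n−1) − winOdd
exceeds α^n·2^(n−1) for infinitely many t — no rule is exponentially close to perfect along any
progression. Decided per rule by the unit-modulus eigen-sector of the gated transfer matrix (census
test M3). S → NoAsympPerfect3 is trivial; the converse holds modulo GapDichotomy3 (CertGlue3,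
PROVED). [difficulty: L] -/
@[route_item "route-QuantumAdvantage-PumpingDial"]
def NoAsympPerfect3 : Prop :=
  ∀ (q r : ℕ) [NeZero q], ∀ α : ℝ, 0 ≤ α → α < 1 → ∀ F : ((Fin q → Fin 3) → (Fin (2 * r + 1) → Bool) → Bool), ∀ per ρ : ℕ, 0 < per → ∀ t₁ : ℕ, ∃ t ≥ t₁, α ^ (ρ + per * t) * (2 : ℝ) ^ (ρ + per * t - 1) < (2 : ℝ) ^ (ρ + per * t - 1) - ((Finset.univ.filter fun x : Fin (ρ + per * t) → Bool => Summit.QuantumAdvantage.AdviceFreeQNC0.OddZeros x ∧ Literature.Computability.QuantumComplexity.RingHLF.Rel x (fun b : Fin (ρ + per * t) => F (fun s : Fin q => (⟨(Finset.univ.filter fun i : Fin (ρ + per * t) => (i.val + (ρ + per * t) - b.val) % (ρ + per * t) % q = s.val ∧ x i = true).card % 3, Nat.mod_lt _ (Nat.succ_pos 2)⟩ : Fin 3)) (fun j : Fin (2 * r + 1) => x ⟨(b.val + ((ρ + per * t) - r % (ρ + per * t)) + j.val) % (ρ + per * t), Nat.mod_lt _ b.pos⟩))).card : ℝ)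

/-- item stmt-QuantumAdvantage-27309 · aside · rank 9 · open · by planner
[support] THEOREM-GRADE, LAND FIRST (finite automata; true whatever T's fate): for every type
(q,3,r) there are θ < 1 and α ∈ [0,1) such that every rule F has a period per > 0 with, along every
residue class ρ mod per, EVENTUALLY either winOdd ≤ θ·2^(n−1) or 2^(n−1) − winOdd ≤ α^n·2^(n−1).
Mechanism: winOdd n F = u·M^n·v for the nonnegative integer transfer matrix (row sums 2) of one
deterministic automaton reading x once; peripheral spectrum of M/2 = roots of unity with trivial
Jordan blocks (Perron–Frobenius per closed class) ⇒ winOdd/2^(n−1) = Σ_ζ c_ζ ζ^n + O(n^d λ^n), λ <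
1, uniformly over the finite type. Banked skeleton piece of S (see NoAsympPerfect3). [difficulty: L] -/
@[route_item "route-QuantumAdvantage-PumpingDial"]
def GapDichotomy3 : Prop :=
  ∀ (q r : ℕ) [NeZero q], ∃ θ : ℝ, θ < 1 ∧ ∃ α : ℝ, 0 ≤ α ∧ α < 1 ∧ ∀ F : ((Fin q → Fin 3) → (Fin (2 * r + 1) → Bool) → Bool), ∃ per : ℕ, 0 < per ∧ ∀ ρ : ℕ, (∃ t₁ : ℕ, ∀ t ≥ t₁, ((Finset.univ.filter fun x : Fin (ρ + per * t) → Bool => Summit.QuantumAdvantage.AdviceFreeQNC0.OddZeros x ∧ Literature.Computability.QuantumComplexity.RingHLF.Rel x (fun b : Fin (ρ + per * t) => F (fun s : Fin q => (⟨(Finset.univ.filter fun i : Fin (ρ + per * t) => (i.val + (ρ + per * t) - b.val) % (ρ + per * t) % q = s.val ∧ x i = true).card % 3, Nat.mod_lt _ (Nat.succ_pos 2)⟩ : Fin 3)) (fun j : Fin (2 * r + 1) => x ⟨(b.val + ((ρ + per * t) - r % (ρ + per * t)) + j.val) % (ρ + per * t), Nat.mod_lt _ b.pos⟩))).card : ℝ)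 ≤ θ * (2 : ℝ) ^ (ρ + per * t - 1)) ∨ (∃ t₁ : ℕ, ∀ t ≥ t₁, (2 : ℝ) ^ (ρ + per * t - 1) - ((Finset.univ.filter fun x : Fin (ρ + per * t) → Bool => Summit.QuantumAdvantage.AdviceFreeQNC0.OddZeros x ∧ Literature.Computability.QuantumComplexity.RingHLF.Rel x (fun b : Fin (ρ + per * t) => F (fun s : Fin q => (⟨(Finset.univ.filter fun i : Fin (ρ + per * t) => (i.val + (ρ + per * t) - b.val) % (ρ + per * t) % q = s.val ∧ x i = true).card % 3, Nat.mod_lt _ (Nat.succ_pos 2)⟩ : Fin 3)) (fun j : Fin (2 * r + 1) => x ⟨(b.val + ((ρ + per * t) - r % (ρ + per * t)) + j.val) % (ρ + per * t), Nat.mod_lt _ b.pos⟩))).card : ℝ) ≤ α ^ (ρ + per * t) * (2 : ℝ) ^ (ρ + per * t - 1))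

/-- item stmt-QuantumAdvantage-27310 · aside · rank 9 · open · by planner
[support] PROVED in the lens node (fsHard_of_gapDichotomy, uniformity over the finite rule type by
Finset.sup; port target, land first): GapDichotomy3 → NoAsympPerfect3 → SteerHardOdd3. The
registered skeleton of S is exactly {stub GapDichotomy3, stub NoAsympPerfect3, S_of = CertGlue3}.
[difficulty: provable-now] -/
@[route_item "route-QuantumAdvantage-PumpingDial"]
def CertGlue3 : Prop :=
  GapDichotomy3 → NoAsympPerfect3 → SteerHardOdd3

/-- item stmt-QuantumAdvantage-27311 · aside · rank 9 · open · by planner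
[support] THEOREM-GRADE (Boolean transfer-matrix powers are eventually periodic): for every type
(q,3,r) ONE period per > 0 and threshold n₁ such that for every rule F and every n ≥ n₁, F is
perfect on the odd class at length n iff at length n + per. With it the exactness slice
NoPerfectSteer3 is DECIDED by one period window [n₁, n₁+per) (node noPerfectFS_of_window, PROVED)
and ONE perfect length n ≥ n₁ pumps to IOPerfect3 (node ioPerfect3_of_zeroPump). [difficulty: M] -/
@[route_item "route-QuantumAdvantage-PumpingDial"]
def ZeroPump3 : Prop :=
  ∀ (q r : ℕ) [NeZero q], ∃ per : ℕ, 0 < per ∧ ∃ n₁ : ℕ, ∀ F : ((Fin q → Fin 3) → (Fin (2 * r + 1) → Bool) → Bool), ∀ n ≥ n₁, ((∀ x : Fin n → Bool, Summit.QuantumAdvantage.AdviceFreeQNC0.OddZeros x → Literature.Computability.QuantumComplexity.RingHLF.Rel x (fun b : Fin n => F (fun s : Fin q => (⟨(Finset.univ.filter fun i : Fin n => (i.val + n - b.val) % n % q = s.val ∧ x i = true).card % 3, Nat.mod_lt _ (Nat.succ_pos 2)⟩ : Fin 3)) (fun j : Fin (2 * r + 1) => x ⟨(b.val + (n - r % n)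 + j.val) % n, Nat.mod_lt _ b.pos⟩))) ↔ (∀ x : Fin (n + per) → Bool, Summit.QuantumAdvantage.AdviceFreeQNC0.OddZeros x → Literature.Computability.QuantumComplexity.RingHLF.Rel x (fun b : Fin (n + per) => F (fun s : Fin q => (⟨(Finset.univ.filter fun i : Fin (n + per) => (i.val + (n + per) - b.val) % (n + per) % q = s.val ∧ x i = true).card % 3, Nat.mod_lt _ (Nat.succ_pos 2)⟩ : Fin 3)) (fun j : Fin (2 * r + 1) => x ⟨(b.val + ((n + per) - r % (n + per)) + j.val) % (n + per), Nat.mod_lt _ b.pos⟩))))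

/-- item stmt-QuantumAdvantage-27312 · aside · rank 9 · open · by planner
[support] EXACTNESS slice (banked; the FS-slice of ExactnessDial's NoPerfectOdd3 stmt-26532 and of
T; necessity from T PROVED in the node): for every type (q,3,r), eventually (n ≥ n₁(q,r)) no
mod-3-gated local rule is perfect on the odd class. Census (A) kit j337947: the symmetric-hash
steered affine rule is perfect for every N ≤ 8 and for NO N ∈ [9,17]; test X1 certifies the pump
window. [difficulty: M] -/
@[route_item "route-QuantumAdvantage-PumpingDial"]
def NoPerfectSteer3 : Prop :=
  ∀ (q r : ℕ) [NeZero q], ∃ n₁ : ℕ, ∀ n ≥ n₁, ∀ F : ((Fin q → Fin 3) → (Fin (2 * r + 1) → Bool) → Bool), ¬ (∀ x : Fin n → Bool, Summit.QuantumAdvantage.AdviceFreeQNC0.OddZeros x → Literature.Computability.QuantumComplexity.RingHLF.Rel x (fun b : Fin n => F (fun s : Fin q => (⟨(Finset.univ.filter fun i : Fin n => (i.val + n - b.val) % n % q = s.val ∧ x i = true).card % 3, Nat.mod_lt _ (Nat.succ_pos 2)⟩ : Fin 3)) (fun j : Fin (2 * r + 1) => x ⟨(b.val + (n - r % n) + j.val)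 % n, Nat.mod_lt _ b.pos⟩)))

/-- item stmt-QuantumAdvantage-27313 · aside · rank 9 · open · by planner
[support] REFUTER LANE = the typed KILL PATH of T (critic row 14's ask): some mod-3-gated local rule
of some fixed type is perfect on the odd class for infinitely many ring lengths. IOPerfect3 → ¬
RingHardOdd 3 PROVED in the node (not_ringHardOdd_of_ioPerfect3); with ZeroPump3 one certified
perfect length n ≥ n₁ suffices (not_ringHardOdd_of_pump). Dormant for q = 1 by census (A); stays
typed for q-periodic gates. [difficulty: M] -/
@[route_item "route-QuantumAdvantage-PumpingDial"]
def IOPerfect3 : Prop :=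
  ∃ (q r : ℕ) (_ : NeZero q) (F : ((Fin q → Fin 3) → (Fin (2 * r + 1) → Bool) → Bool)), ∀ n₁ : ℕ, ∃ n ≥ n₁, (∀ x : Fin n → Bool, Summit.QuantumAdvantage.AdviceFreeQNC0.OddZeros x → Literature.Computability.QuantumComplexity.RingHLF.Rel x (fun b : Fin n => F (fun s : Fin q => (⟨(Finset.univ.filter fun i : Fin n => (i.val + n - b.val) % n % q = s.val ∧ x i = true).card % 3, Nat.mod_lt _ (Nat.succ_pos 2)⟩ : Fin 3)) (fun j : Fin (2 * r + 1) => x ⟨(b.val + (n - r % n) + j.val) % n, Nat.mod_lt _ b.pos⟩)))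

/-- item stmt-QuantumAdvantage-27314 · aside · rank 9 · open · by planner
[support] PROVED in the lens node (BC5 WITNESS of S, one gate digit below: m = 1 = ungated local
rules): for every (q,r), θ < 1 and n₀ with every radius-r local rule winning ≤ θ·2^(n−1) odd
patterns for n ≥ n₀ — the tree theorem ringLocal_polylog_lt3 at constant radius. Outside T's known
regime: T's smallest slice (affine, DegreeDial AffineCore3 24214) is open while this digit is a
theorem. [difficulty: provable-now] -/
@[route_item "route-QuantumAdvantage-PumpingDial"]
def LocalHardOdd3 : Prop :=
  ∀ (q r : ℕ) [NeZero q], ∃ θ : ℝ, θ < 1 ∧ ∃ n₀ : ℕ, ∀ n ≥ n₀, ∀ F : ((Fin q → Fin 1) → (Fin (2 * r + 1) → Bool) → Bool), ((Finset.univ.filter fun x : Fin n → Bool => Summit.QuantumAdvantage.AdviceFreeQNC0.OddZeros x ∧ Literature.Computability.QuantumComplexity.RingHLF.Rel x (fun b : Fin n => F (fun s : Fin q => (⟨(Finset.univ.filter fun i : Fin n => (i.val + n - b.val) % n % q = s.val ∧ x i = true).card % 1, Nat.mod_lt _ (Nat.succ_pos 0)⟩ : Fin 1)) (fun j : Fin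 (2 * r + 1) => x ⟨(b.val + (n - r % n) + j.val) % n, Nat.mod_lt _ b.pos⟩))).card : ℝ) ≤ θ * (2 : ℝ) ^ (n - 1)

/-- item stmt-QuantumAdvantage-27315 · aside · rank 9 · open · by planner
[support] PROVED in the lens node (BC5 WITNESS of SymGatedHardOdd3 / of U's conclusion one digit
below): ONE θ < 1 for ALL ungated local rules of radius ≤ (log₂ n)^c, every c —
ringLocal_polylog_lt3 verbatim in rule-table vocabulary. [difficulty: provable-now] -/
@[route_item "route-QuantumAdvantage-PumpingDial"]
def LocalUniform3 : Prop :=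
  ∃ θ : ℝ, θ < 1 ∧ ∀ c : ℕ, ∃ n₀ : ℕ, ∀ n ≥ n₀, ∀ (q r : ℕ) [NeZero q], r ≤ (Nat.log 2 n) ^ c → ∀ F : ((Fin q → Fin 1) → (Fin (2 * r + 1) → Bool) → Bool), ((Finset.univ.filter fun x : Fin n → Bool => Summit.QuantumAdvantage.AdviceFreeQNC0.OddZeros x ∧ Literature.Computability.QuantumComplexity.RingHLF.Rel x (fun b : Fin n => F (fun s : Fin q => (⟨(Finset.univ.filter fun i : Fin n => (i.val + n - b.val) % n % q = s.val ∧ x i = true).card % 1, Nat.mod_lt _ (Nat.succ_pos 0)⟩ : Fin 1)) (fun j : Fin (2 * r + 1) => x ⟨(b.val + (n - r % n) + j.val) % n, Nat.mod_lt _ b.pos⟩))).card : ℝ) ≤ θ * (2 : ℝ) ^ (n - 1)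

/-- item stmt-QuantumAdvantage-27316 · aside · rank 9 · open · by planner
[support] ALL-PATTERN TWIN in ProductDial's loss grammar (banked; NECESSARY for
ProductDial.PolyLoss3 stmt-26123 — PolyLoss3 → SteerPolyLoss3 PROVED in the node): for every type
(q,3,r) there are k, n₀ with every rule winning at most (1 − n^{−k})·2^n of ALL patterns for n ≥ n₀.
The lift SteerPolyLoss3 → PolyLoss3 (node closes₃, residual strictly below T) is NOT filed
(ProductDial is at its 15-item cap); recorded here for the junction. [difficulty: M] -/
@[route_item "route-QuantumAdvantage-PumpingDial"]
def SteerPolyLoss3 : Prop :=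
  ∀ (q r : ℕ) [NeZero q], ∃ k n₀ : ℕ, ∀ n ≥ n₀, ∀ F : ((Fin q → Fin 3) → (Fin (2 * r + 1) → Bool) → Bool), ((Finset.univ.filter fun x : Fin n → Bool => Literature.Computability.QuantumComplexity.RingHLF.Rel x (fun b : Fin n => F (fun s : Fin q => (⟨(Finset.univ.filter fun i : Fin n => (i.val + n - b.val) % n % q = s.val ∧ x i = true).card % 3, Nat.mod_lt _ (Nat.succ_pos 2)⟩ : Fin 3)) (fun j : Fin (2 * r + 1) => x ⟨(b.val + (n - r % n) + j.val) % n, Nat.mod_lt _ b.pos⟩))).card : ℝ) ≤ (1 - 1 / (n : ℝ) ^ k) * (2 : ℝ) ^ n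

/-- item stmt-QuantumAdvantage-27317 · aside · rank 9 · open · by planner
[support] composite residual U∘R kept for the one-residual reading (node closes₁: S → SteerLift3 →
leaf): SteerHardOdd3 → RingHardOdd 3. Banked, T-grade. [difficulty: open-problem] -/
@[route_item "route-QuantumAdvantage-PumpingDial"]
def SteerLift3 : Prop :=
  SteerHardOdd3 → Summit.QuantumAdvantage.AdviceFreeQNC0.RingHardOdd 3

/-- item stmt-QuantumAdvantage-27318 · assembly · rank 1 · open · by planner
sources: arXiv:1704.00690
[assembly] SteerHardOdd3 → UniformityLift3 → SymGatedLift3 → AdviceFreeQNC0Three -/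
@[route_item "route-QuantumAdvantage-PumpingDial"]
def Assembly : Prop :=
  SteerHardOdd3 → UniformityLift3 → SymGatedLift3 → Summit.QuantumAdvantage.AdviceFreeQNC0.AdviceFreeQNC0Three

/-! D-0027 §2.1 — DECIDING THEOREM (planner-authored via `route open/edit --closes-file`; by planner-decomp-qadv-writer-1-g2-0 2026-08-30T04:04:39Z):
its hypotheses are this route's items and its conclusion the registered leaf `Summit.QuantumAdvantage.AdviceFreeQNC0.AdviceFreeQNC0Three` (rung F-Q1-p3, D-0061) (glue_lint), and it elaborates with this file. -/

@[closes "route-QuantumAdvantage-PumpingDial"] theorem closes (hS : SteerHardOdd3) (hU : UniformityLift3) (hR : SymGatedLift3) :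
    Summit.QuantumAdvantage.AdviceFreeQNC0.AdviceFreeQNC0Three :=
  Summit.QuantumAdvantage.AdviceFreeQNC0.adviceFreeQNC0Three_of_ringHardOdd (hR (hU hS))

end Summit.QuantumAdvantage.QuantumAdvantage.Theses.PumpingDial
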